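import Mathlib
import Summits.ValiantsHypothesis.ValiantsHypothesis.Theorems.NewtonUnitEquationsTwoProductsFormalLogLinearisationLiftedHyperbolicCross
import HarnessLib

/-!
# Route NewtonUnitEquations — crux `TwoProducts` (stmt-ValiantsHypothesis-5906), line `formal-log-linearisation`:
# the lifted pencil count on TWO tail monomials is `O(√m)`, not `2m` (theory lane on the OPEN stub 5)

Registered line `Cruxes/TwoProducts/Lines/formal-log-linearisation.lean` (NOT the item's skeleton of record; helper
mode `--supports stmt-ValiantsHypothesis-5906 --as helper`, no stub credit claimed).  Sequel to
`Theorems/NewtonUnitEquationsTwoProductsFormalLogLinearisationLiftedHyperbolicCross.lean`.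

For two `m`-point configurations `A, B ⊂ ℂ^s` with unequal-moment function `G(μ) = Σ_j A_j^μ − Σ_j B_j^μ`, the
pencil-visible multi-indices (strict `(θ₁ + cθ₂)`-minimisers of `{G ≠ 0}`, `θ₁, θ₂ > 0`) lie in the hyperbolic cross
`∏ (μ_i + 1) ≤ 2m` (previous file) and form an ANTICHAIN for the componentwise order (a componentwise-smaller point of
`{G ≠ 0}` is lighter for every positive grading).  On two monomials (`s = 2`) an antichain inside
`{(p,q) : (p+1)(q+1) ≤ n}` has at most `2·⌊√n⌋` elements (every point has `p + 1 ≤ √n` or `q + 1 ≤ √n`, and each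
coordinate is injective on an antichain of `ℕ²`).  Hence:

* `antichain_hyperbola_card_le` — the combinatorial count (`Fin 2 → ℕ`, any `n`);
* `pencilVisible_antichain` — pencil-visible unequal moments are pairwise incomparable (any `s`);
* `liftedPencilCount_twoMonomials` — **for `s = 2` every finite set of pencil-visible unequal moments of two
  `m`-point configurations has at most `2·⌊√(2m)⌋` elements** (verbatim hypothesis shape of the memo's
  `LiftedPencilCount` at `s = 2`).

This sharpens the common-two-monomial-cone count of the Disproof (§3 F4, `card_corners_le_of_expSum`: `≤ 2m` by a
rank argument; `corners_rank_tight` there is tightness for ARBITRARY rank-`2m` matrices, not for exponential sums) in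
the lifted currency; transporting it to the planar rung `EngineCommonConeRung` (p587085, independent `e₁, e₂`, where
planar and lifted visibility coincide) is left to that file's owner.  Honest framing: an elementary count for the THEORY
lane of an OPEN engine; the engine `stub_logSumEngine` (open content: fibre cancellation + the extreme regime
`s ≥ 2^{Ω(m/log m)}`, memo v2) and the crux `TwoProducts` stay OPEN, the line is not the item's skeleton of record, and
nothing here is progress on `VP ≠ VNP` (NOT proved). No definitions, no named facts.
-/

noncomputable section

-- Sub = Summit single-conjunct layout: the duplicated namespace component is mandated by the tree.
set_option linter.dupNamespace false

namespace Summit.ValiantsHypothesis.ValiantsHypothesis.Theorems.NewtonUnitEquations.TwoProducts.FormalLogLinearisation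

open scoped BigOperators

/-- **Antichains in a hyperbola region of `ℕ²` are short.**  If `S ⊆ ℕ²` (as `Fin 2 → ℕ`) is an antichain for the
componentwise order and every `μ ∈ S` has `(μ₀ + 1)(μ₁ + 1) ≤ n`, then `#S ≤ 2·⌊√n⌋`: each point has `μ₀ + 1 ≤ ⌊√n⌋` or
`μ₁ + 1 ≤ ⌊√n⌋`, and each coordinate is injective on an antichain. [folklore] -/
theorem antichain_hyperbola_card_le (n : ℕ) (S : Finset (Fin 2 → ℕ))
    (hcross : ∀ μ ∈ S, (μ 0 + 1) * (μ 1 + 1) ≤ n)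
    (hanti : ∀ μ ∈ S, ∀ ν ∈ S, μ ≤ ν → μ = ν) :
    S.card ≤ 2 * Nat.sqrt n := by
  classical
  -- each coordinate is injective on `S`
  have hinj : ∀ (k : Fin 2), Set.InjOn (fun μ : Fin 2 → ℕ => μ k) ↑S := by
    intro k μ hμ ν hν hk
    simp only at hk
    -- the other coordinate decides comparability
    set k' : Fin 2 := if k = 0 then 1 else 0 with hk'
    have hcoords : ∀ i : Fin 2, i = k ∨ i = k' := by
      intro i; fin_cases i <;> fin_cases k <;> simp [hk']
    rcases le_total (μ k') (ν k') with h | h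
    · exact hanti μ hμ ν hν fun i => by
        rcases hcoords i with rfl | rfl
        · exact hk.le
        · exact h
    · exact (hanti ν hν μ hμ fun i => by
        rcases hcoords i with rfl | rfl
        · exact hk.ge
        · exact h).symm
  -- split `S` by which coordinate is small
  set r := Nat.sqrt n with hr
  have hsmall : ∀ μ ∈ S, μ 0 + 1 ≤ r ∨ μ 1 + 1 ≤ r := by
    intro μ hμ
    by_contra h
    push Not at h
    have h0 : r + 1 ≤ μ 0 + 1 := h.1
    have h1 : r + 1 ≤ μ 1 + 1 := h.2
    have hn : n < (r + 1) * (r + 1) := Nat.lt_succ_sqrt n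
    have := Nat.mul_le_mul h0 h1
    have := hcross μ hμ
    omega
  have hsub : S ⊆ S.filter (fun μ => μ 0 + 1 ≤ r) ∪ S.filter (fun μ => μ 1 + 1 ≤ r) := by
    intro μ hμ
    rcases hsmall μ hμ with h | h
    · exact Finset.mem_union_left _ (Finset.mem_filter.mpr ⟨hμ, h⟩)
    · exact Finset.mem_union_right _ (Finset.mem_filter.mpr ⟨hμ, h⟩)
  have hpart : ∀ k : Fin 2, (S.filter fun μ => μ k + 1 ≤ r).card ≤ r := by
    intro k
    calc (S.filter fun μ => μ k + 1 ≤ r).card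
        ≤ (Finset.range r).card := by
          refine Finset.card_le_card_of_injOn (fun μ => μ k) (fun μ hμ => ?_) ?_
          · have := (Finset.mem_filter.mp hμ).2
            have hk : μ k < r := by omega
            simpa using hk
          · exact (hinj k).mono (Finset.coe_subset.mpr (Finset.filter_subset _ _))
      _ = r := Finset.card_range r
  calc S.card ≤ (S.filter (fun μ => μ 0 + 1 ≤ r) ∪ S.filter (fun μ => μ 1 + 1 ≤ r)).card :=
        Finset.card_le_card hsub
    _ ≤ (S.filter fun μ => μ 0 + 1 ≤ r).card + (S.filter fun μ => μ 1 + 1 ≤ r).card :=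
        Finset.card_union_le _ _
    _ ≤ r + r := Nat.add_le_add (hpart 0) (hpart 1)
    _ = 2 * Nat.sqrt n := by rw [hr]; ring

/-- **Pencil-visible points are pairwise incomparable** (any `s`): if `μ ≠ ν` are both pencil-visible unequal moments
(each the strict minimiser of `{G ≠ 0}` for its own strictly positive grading `θ₁ + cθ₂`), then `¬ μ ≤ ν`
componentwise — otherwise `μ ∈ {G ≠ 0}` would be at most as heavy as `ν` for `ν`'s grading. [folklore] -/
theorem pencilVisible_antichain {m s : ℕ} (A B : Fin m → Fin s → ℂ) (θ₁ θ₂ : Fin s → ℝ)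
    (hθ₁ : ∀ i, 0 < θ₁ i) (hθ₂ : ∀ i, 0 < θ₂ i) (μ ν : Fin s → ℕ)
    (hμ : (∑ j, ∏ i, A j i ^ μ i) ≠ (∑ j, ∏ i, B j i ^ μ i))
    (hν : ∃ c : ℝ, 0 < c ∧ ∀ ν' : Fin s → ℕ, ν' ≠ ν →
        (∑ j, ∏ i, A j i ^ ν' i) ≠ (∑ j, ∏ i, B j i ^ ν' i) →
          ∑ i, (θ₁ i + c * θ₂ i) * (ν i : ℝ) < ∑ i, (θ₁ i + c * θ₂ i) * (ν' i : ℝ))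
    (hle : μ ≤ ν) : μ = ν := by
  by_contra hne
  obtain ⟨c, hc, hstrict⟩ := hν
  have hlt := hstrict μ hne hμ
  have hge : ∑ i, (θ₁ i + c * θ₂ i) * (μ i : ℝ) ≤ ∑ i, (θ₁ i + c * θ₂ i) * (ν i : ℝ) := by
    refine Finset.sum_le_sum fun i _ => ?_
    have hθ : 0 ≤ θ₁ i + c * θ₂ i := by have := hθ₁ i; have := hθ₂ i; positivity
    exact mul_le_mul_of_nonneg_left (by exact_mod_cast hle i) hθ
  linarith

/-- **Lifted pencil count on two monomials: `≤ 2⌊√(2m)⌋`.**  In the verbatim hypothesis shape of the memo's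
`LiftedPencilCount` at `s = 2` (`A B : Fin m → Fin 2 → ℂ`, strictly positive `θ₁, θ₂`), every finite set of
pencil-visible unequal moments has at most `2·⌊√(2m)⌋` elements: it is an antichain (`pencilVisible_antichain`) inside
the hyperbolic cross `(μ₀+1)(μ₁+1) ≤ 2m` (`unequalMoment_pencilVisible_hyperbolicCross`), and such antichains are short
(`antichain_hyperbola_card_le`).  Compare the rank bound `2m` of the Disproof's F4. [folklore] -/
theorem liftedPencilCount_twoMonomials {m : ℕ} (A B : Fin m → Fin 2 → ℂ) (θ₁ θ₂ : Fin 2 → ℝ)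
    (hθ₁ : ∀ i, 0 < θ₁ i) (hθ₂ : ∀ i, 0 < θ₂ i) (S : Finset (Fin 2 → ℕ))
    (hS : ∀ μ ∈ S, (∑ j, ∏ i, A j i ^ μ i) ≠ (∑ j, ∏ i, B j i ^ μ i) ∧
      ∃ c : ℝ, 0 < c ∧ ∀ ν : Fin 2 → ℕ, ν ≠ μ →
        (∑ j, ∏ i, A j i ^ ν i) ≠ (∑ j, ∏ i, B j i ^ ν i) →
          ∑ i, (θ₁ i + c * θ₂ i) * (μ i : ℝ) < ∑ i, (θ₁ i + c * θ₂ i) * (ν i : ℝ)) :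
    S.card ≤ 2 * Nat.sqrt (2 * m) := by
  refine antichain_hyperbola_card_le (2 * m) S (fun μ hμ => ?_) (fun μ hμ ν hν hle => ?_)
  · have h := unequalMoment_pencilVisible_hyperbolicCross A B θ₁ θ₂ μ (hS μ hμ)
    simpa [Fin.prod_univ_two] using h
  · exact pencilVisible_antichain A B θ₁ θ₂ hθ₁ hθ₂ μ ν (hS μ hμ).1 (hS ν hν).2 hle

end Summit.ValiantsHypothesis.ValiantsHypothesis.Theorems.NewtonUnitEquations.TwoProducts.FormalLogLinearisation

end
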